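/-
Copyright: statement-level skeleton of a published paper (lit-balaban cell, reader/typer r15). No proof claims beyond
what the kernel checks below.
-/
import Mathlib
import Literature.MathematicalPhysics.QuantumFieldTheory.Balaban1983to89.B3Sect2Statements

/-!
# B3 — T. Bałaban, *(Higgs)₂,₃ quantum fields in a finite volume. III. Renormalization*, CMP **88** (1983) 411–445,
Sect. 2 pp. 426–428: the first estimate (2.13)–(2.14) of a localized graph expression and the summation targets
(2.15), (2.16) in the proof of Proposition 2.1

statement-level skeleton of published theorems with citation tags; proofs where landed; nothing here is a claim about
the Yang–Mills mass gap

Source: held text `paper:balaban1983-higgs-2-3-quantum-fields-finite-volume` (journal page = PDF page + 410); displays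
read on the ×2 renders `pub-balaban/b2b-balaban-ref1/pages/1983-cmp88-higgs23-III/1983-cmp88-higgs23-III-p016,
p017, p018-x2.png` (pp. 426, 427, 428).  SKELETON rows B3.Eq2.13-2.14 and B3.Eq2.15-2.16 of
`HOME/lit-balaban-r15/ROWS-B3.md` (fold owner r15).  Companions: `B3Sect2Statements` ((2.1)–(2.4), (2.17), the
p. 427 geometric sum `sum_scalePow_le`), `B3Sect2StatementsPart2` ((2.5), (2.10)–(2.12): the line bounds fed into
(2.13)), `B3Prop1` (Props. 2.1–2.2 as statements), `B3` ((2.6)–(2.7)).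

## What is typed here, and how

The proof of Proposition 2.1 (pp. 425–428) estimates the scale-decomposed, localized expression `E(G(j), {□(v)},
Φ′_ext, A_ext)` of a connected graph `G` whose lines carry the scale indices `j = (j_l)` of (2.6)–(2.7) by taking
absolute values, applying (2.5), (2.10)–(2.12) to the lines, localizing every vertex `v` to cubes `Δ(v) ⊂ □(v)` of
size `L^{j(v)}η`, `j(v)` = the lowest index of the lines at `v`, and splitting the exponential factors.  The result is
the bound **(2.13)** by the purely combinatorial weight **(2.14)** `Ẽ(G(j), {□(v)})`, and *"To prove the theorem it
is sufficient to prove that Σ_{j∈J(l̃)} Σ_{{Δ(v)}} Ẽ(G(j), {Δ(v)}) ≦ O(1) (2.15)"*, established by the shrinking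
induction (2.15′)/(2.16) over the subgraphs `G_1 ⊂ G_2 ⊂ … ⊂ G_m = G` of the ordering `l̃`.

* `ScaledGraph` is the COMBINATORIAL carrier of (2.14): vertices, lines with their two endpoints (p. 415: *"every
  internal line has a vertex at each endpoint"*; every vertex lies on a line — `touches`, true for the connected graphs
  with at least one line of p. 415), per-vertex incidence data of (2.1) (differentiations of `v` acting on a line,
  vector-field legs of a line in a vertex of the form (1.14)/(1.15)), the *"proper power of L^{j(v)}η for vertices
  (1.8), (1.9), (1.10), (1.11)"* (`etaPow v`, the printed text leaves it implicit: it is the number of extra factors η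
  of the vertex, cf. (2.1)), the localization cubes with their distance and the finite family of admissible
  localizations `{Δ(v)}_{v∈G}`, `Δ(v) ⊂ □(v)`, `|Δ(v)| = (L^{j(v)}η)^d` (`locs`), and the constants `L, η, d, δ₁`.
  `lowestIndex` computes `j(v)`; `weight214` is the summand of (2.14) and `Etilde` the display (2.14) itself — ALL
  DEFINITIONS WITH BODIES.
* **(2.13)** is the CLAIM `Ineq213` (a `Prop`, hypotheses for consumers): for the supplied values
  `Eval j = E(G(j), {□(v)}, Φ′_ext, A_ext)` of the expression at the scale assignments `j ∈ J(l̃)` (the assignments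
  compatible with the ordering `l̃`, (2.7)), the couplings/degrees/norms of (1.33), the bound by `Etilde`.
* **(2.15)** (p. 427, the target): `Ineq215`.  **(2.15′)** (p. 428, after shrinking `G_1`) and the inductive
  **(2.16)**: `Ineq216`, stated between the weight sums of `G` and of a SECOND carrier instance standing for the
  quotient graph `G/G_i` (p. 428: *"A graph G/G_i is defined as a graph obtained from G by shrinking all connected
  components G_i^{(α)} of G_i to points"*), with the projected index set `J(l̃)_i`, the next line `l(i+1)` and the
  exponent `Σ_α D(G_i^{(α)})` supplied — the quotient construction itself is NOT modelled (carrier clause).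
  PROVED here: only bookkeeping (`Etilde_nonneg`, the case `i = m` reading of (2.16): a graph shrunk to a point has
  weight sum = number of localizations, `Etilde_noLines`).  The summation step *"Σ_{j=0}^{j_{l(2)}} (L^jη)^{D(G₁)} ≦
  O(1)(L^{j_{l(2)}}η)^{D(G₁)}"* is `B3Sect2Statements.sum_scalePow_le` (PROVED there).  Nothing of the paper beyond
  the displayed definitions is asserted.
-/

open scoped BigOperators

namespace Literature.MathematicalPhysics.QuantumFieldTheory.Balaban1983to89.B3Sect2FirstEstimate

/-! ## The combinatorial carrier of (2.14) -/

/-- The combinatorial data of a connected graph `G` entering the weight (2.14) p. 427 [PDF 17]: vertices `V`, internal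
lines `Ln` with their endpoints (p. 415: *"every internal line has a vertex at each endpoint"*), every vertex on some
line (`touches`; p. 415: graphs are connected with at least one internal line), the incidence numbers of (2.1) p. 422 —
differentiations of `v` acting on the line `l` (`diffOn`), legs of `l` that are vector-field legs of a vertex `v` of the
form (1.14)/(1.15) (`vecLegAvg`) —, the *"proper power of L^{j(v)}η for vertices (1.8), (1.9), (1.10), (1.11)"*
(`etaPow`), the localization cubes `Cube` with the (scaled) distance `dist(Δ, Δ′)` and the finite family `locs` of
admissible localizations `{Δ(v)}_{v∈G}` (*"We localize further the expression to cubes Δ(v) of the size L^{j(v)}η"*,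
`Δ(v) ⊂ □(v)`), and the constants `L`, `η = L^{−k}`, `d`, `δ₁` of (2.10).  Carrier clauses: `locs`, `etaPow`,
`diffOn`, `vecLegAvg` are data of the instance. [cite: Balaban1983Higgs3, (2.14) p.427] -/
structure ScaledGraph where
  /-- vertices of G -/
  V : Type
  /-- internal lines of G -/
  Ln : Type
  instFintypeV : Fintype V
  instFintypeLn : Fintype Ln
  instDecEqV : DecidableEq V
  /-- the two endpoints of a line (possibly equal) -/
  src : Ln → V
  tgt : Ln → V
  /-- every vertex is an endpoint of some line (connected graph with ≥ 1 line, p. 415) -/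
  touches : ∀ v : V, ∃ l : Ln, src l = v ∨ tgt l = v
  /-- number of differentiations in `v` acting on the line `l` ((2.1)) -/
  diffOn : V → Ln → ℕ
  /-- number of legs of `l` that are vector-field legs of `v`, `v` of the form (1.14)/(1.15) (else 0) ((2.1)) -/
  vecLegAvg : V → Ln → ℕ
  /-- the "proper power of L^{j(v)}η" of the vertex `v` ((2.14); the extra factors η of (2.1)) -/
  etaPow : V → ℕ
  /-- localization cubes Δ -/
  Cube : Type
  /-- dist(Δ, Δ′) -/
  dist : Cube → Cube → ℝ
  /-- the admissible localizations {Δ(v)}_{v ∈ G}, Δ(v) ⊂ □(v), |Δ(v)| = (L^{j(v)}η)^d -/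
  locs : Finset (V → Cube)
  /-- block size L -/
  L : ℝ
  /-- lattice spacing η = L^{−k} -/
  η : ℝ
  /-- dimension d -/
  d : ℕ
  /-- the decay rate δ₁ of (2.10) -/
  δ₁ : ℝ
  one_lt_L : 1 < L
  η_pos : 0 < η

namespace ScaledGraph

variable (G : ScaledGraph)

/-- The vertices of the carrier form a finite type (carrier field). [cite: Balaban1983Higgs3, (2.14) p.427] -/
instance : Fintype G.V := G.instFintypeV

/-- The lines of the carrier form a finite type (carrier field). [cite: Balaban1983Higgs3, (2.14) p.427] -/
instance : Fintype G.Ln := G.instFintypeLn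

/-- Decidable equality of vertices (carrier field; needed to count the legs of a line in a vertex).
[cite: Balaban1983Higgs3, (2.14) p.427] -/
instance : DecidableEq G.V := G.instDecEqV

/-- `L^jη`, the length scale of index `j` ((2.10)). [cite: Balaban1983Higgs3, (2.10) p.426] -/
noncomputable def scale (j : ℕ) : ℝ := G.L ^ j * G.η

/-- The scales are positive (`L > 1`, `η > 0`). [cite: Balaban1983Higgs3, (2.10) p.426] -/
theorem scale_pos (j : ℕ) : 0 < G.scale j :=
  mul_pos (pow_pos (by linarith [G.one_lt_L]) j) G.η_pos

/-- The number of legs of the line `l` in the vertex `v` (0, 1 or 2: both endpoints may lie in `v`).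
[cite: Balaban1983Higgs3, (2.14) p.427] -/
def legsOn (v : G.V) (l : G.Ln) : ℕ :=
  (if G.src l = v then 1 else 0) + (if G.tgt l = v then 1 else 0)

/-- The lines with an end in `v`. [cite: Balaban1983Higgs3, (2.14) p.427] -/
def linesAt (v : G.V) : Finset G.Ln :=
  Finset.univ.filter fun l => G.src l = v ∨ G.tgt l = v

/-- Every vertex has a line (carrier field `touches`). [cite: Balaban1983Higgs3, p.415] -/
theorem linesAt_nonempty (v : G.V) : (G.linesAt v).Nonempty := by
  obtain ⟨l, hl⟩ := G.touches v
  exact ⟨l, by simp [linesAt, hl]⟩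

/-- p. 426 [PDF 16]: *"For a vertex v ∈ G(j) let j(v) be a lowest index of the lines with an end in this vertex."*
[cite: Balaban1983Higgs3, (2.14) p.426] -/
noncomputable def lowestIndex (j : G.Ln → ℕ) (v : G.V) : ℕ :=
  (G.linesAt v).inf' (G.linesAt_nonempty v) j

/-- `j(v) ≤ j_l` for every line `l` with an end in `v`. [cite: Balaban1983Higgs3, (2.14) p.426] -/
theorem lowestIndex_le (j : G.Ln → ℕ) {v : G.V} {l : G.Ln} (hl : G.src l = v ∨ G.tgt l = v) :
    G.lowestIndex j v ≤ j l :=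
  Finset.inf'_le _ (by simp [linesAt, hl])

/-- The vertex factor of **(2.14)** p. 427 at the scale assignment `j` (for a fixed localization the cubes enter only
through the line factors): `(L^{j(v)}η)^d · Π_{legs of lines l with ends in v} (L^{j_l}η)^{−(d−2)/2} ·
Π_{differentiations in v acting on lines l} (L^{j_l}η)^{−1} · [(L^{j(v)}η)^{(proper power)}] ·
Π_{legs of lines l of vector fields, v of the form (1.14), (1.15)} L^{j_l}η`. [cite: Balaban1983Higgs3, (2.14) p.427] -/
noncomputable def vertexFactor (j : G.Ln → ℕ) (v : G.V) : ℝ :=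
  G.scale (G.lowestIndex j v) ^ G.d
    * (∏ l : G.Ln, G.scale (j l) ^ (-(((G.d : ℝ) - 2) / 2) * (G.legsOn v l : ℝ)))
    * (∏ l : G.Ln, (G.scale (j l))⁻¹ ^ G.diffOn v l)
    * G.scale (G.lowestIndex j v) ^ G.etaPow v
    * ∏ l : G.Ln, G.scale (j l) ^ G.vecLegAvg v l

/-- The line factor of **(2.14)**: `exp[−½δ₁(L^{j_l}η)^{−1} dist(Δ(v), Δ(v′))]`, `v, v′` the endpoints of `l`.
[cite: Balaban1983Higgs3, (2.14) p.427] -/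
noncomputable def lineFactor (j : G.Ln → ℕ) (Δ : G.V → G.Cube) (l : G.Ln) : ℝ :=
  Real.exp (-(G.δ₁ / 2 * (G.scale (j l))⁻¹ * G.dist (Δ (G.src l)) (Δ (G.tgt l))))

/-- The summand of (2.14) at one localization `{Δ(v)}`. [cite: Balaban1983Higgs3, (2.14) p.427] -/
noncomputable def weight214 (j : G.Ln → ℕ) (Δ : G.V → G.Cube) : ℝ :=
  (∏ v : G.V, G.vertexFactor j v) * ∏ l : G.Ln, G.lineFactor j Δ l

/-- **(2.14)** p. 427 [PDF 17], verbatim: *"Ẽ(G(j), {□(v)}_{v∈G}) = Σ_{{Δ(v)}} Π_{vertices v∈G} ((L^{j(v)}η)^d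
Π_{legs of lines l with ends in v} (L^{j_l}η)^{−(d−2)/2} Π_{differentiations in v acting on lines l} (L^{j_l}η)^{−1} ·
[a proper power of L^{j(v)}η for vertices (1.8), (1.9), (1.10), (1.11)] · Π_{legs of lines l of vector fields in the case
when v is of the form (1.14), (1.15)} L^{j_l}η) Π_{lines l∈G} exp[−½δ₁(L^{j_l}η)^{−1}dist(Δ(v), Δ(v′))]. (2.14)"*
[cite: Balaban1983Higgs3, (2.14) p.427] -/
noncomputable def Etilde (j : G.Ln → ℕ) : ℝ :=
  ∑ Δ ∈ G.locs, G.weight214 j Δ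

/-- Every factor of (2.14) is nonnegative, hence so is `Ẽ`. [cite: Balaban1983Higgs3, (2.14) p.427] -/
theorem Etilde_nonneg (j : G.Ln → ℕ) : 0 ≤ G.Etilde j := by
  refine Finset.sum_nonneg fun Δ _ => mul_nonneg ?_ ?_
  · refine Finset.prod_nonneg fun v _ => ?_
    unfold vertexFactor
    have hs : ∀ i, 0 ≤ G.scale i := fun i => (G.scale_pos i).le
    refine mul_nonneg (mul_nonneg (mul_nonneg (mul_nonneg (pow_nonneg (hs _) _) ?_) ?_) (pow_nonneg (hs _) _)) ?_
    · exact Finset.prod_nonneg fun l _ => Real.rpow_nonneg (hs _) _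
    · exact Finset.prod_nonneg fun l _ => pow_nonneg (inv_nonneg.mpr (hs _)) _
    · exact Finset.prod_nonneg fun l _ => pow_nonneg (hs _) _
  · exact Finset.prod_nonneg fun l _ => (Real.exp_pos _).le

end ScaledGraph

/-! ## (2.13), (2.15), (2.16) — the claims -/

section Claims

variable (G : ScaledGraph)

/-- **(2.13)** p. 426 [PDF 16], verbatim: *"After all these operations we get the following inequality:
|Σ_{j∈J(l̃)} E(G(j), {□(v)}_{v∈G}, Φ′_ext, A_ext)| ≦ O(1)(e(L^kε))^{d_v(G)}(λ(L^kε))^{d_s(G)} exp[−(δ₁/2) d({□(v)}_{v∈G})]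
· ‖hΦ_ext‖₁‖h′A_ext‖₁ Σ_{j∈J(l̃)} Ẽ(G(j), {□(v)}_{v∈G}), (2.13) where O(1) is a constant depending on n̄ only"* — at the
constant `C` = O(1), for the supplied values `Eval j` of the expression at the scale assignments `j ∈ J` (= `J(l̃)`,
the assignments of an ordering, (2.7)), running couplings `eRun`, `lamRun` with the powers `dv`, `ds` of (1.33), the
tree length `dtree = d({□(v)})` and the norm products `normPhi`, `normA` (= ‖hΦ_ext‖₁, ‖h′A_ext‖₁, the products of
the localized ‖·‖_{1,α₀} norms of (1.33)). [cite: Balaban1983Higgs3, (2.13) p.426] -/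
def Ineq213 (C : ℝ) (J : Finset (G.Ln → ℕ)) (Eval : (G.Ln → ℕ) → ℝ) (eRun lamRun : ℝ) (dv ds : ℕ)
    (dtree normPhi normA : ℝ) : Prop :=
  |∑ j ∈ J, Eval j|
    ≤ C * eRun ^ dv * lamRun ^ ds * Real.exp (-(G.δ₁ / 2 * dtree)) * normPhi * normA * ∑ j ∈ J, G.Etilde j

/-- **(2.15)** p. 427 [PDF 17], verbatim: *"To prove the theorem it is sufficient to prove that
Σ_{j∈J(l̃)} Σ_{{Δ(v)}} Ẽ(G(j), {Δ(v)}_{v∈G}) ≦ O(1) (2.15) with O(1) depending on n̄ and δ₁ only."* (the inner sum over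
the localizations is inside `Etilde`). [cite: Balaban1983Higgs3, (2.15) p.427] -/
def Ineq215 (C : ℝ) (J : Finset (G.Ln → ℕ)) : Prop :=
  ∑ j ∈ J, G.Etilde j ≤ C

/-- **(2.15′)** p. 428 (the effect of shrinking `G₁`) and the inductive assumption **(2.16)** p. 428 [PDF 18], verbatim:
*"Σ_{j∈J(l̃)} Σ_{{Δ(v)}_{v∈G}} Ẽ(G(j), {Δ(v)}_{v∈G}) ≦ Σ_{j∈J(l̃)_i} Σ_{{Δ(v)}_{v∈G/G_i}} O(1)(L^{j_{l(i+1)}}η)^{Σ_α D(G_i^{(α)})}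
Ẽ(G/G_i(j), {Δ(v)}_{v∈G/G_i}), (2.16) where O(1) depends on δ₁, n̄ only and an exponent δ_{i+1} in the exponential factors on
the right side is positive and depends on δ₁, n̄"* ((2.15′) is the case `i = 1` with the exponent `D(G₁)`).  Stated between
the weight sums of `G` over `J = J(l̃)` and of a second carrier `Gq` standing for the quotient graph `G/G_i` (its `δ₁`
field playing the role of `δ_{i+1}`), with the projected index set `Jq = J(l̃)_i`, the line `lnext = l(i+1)` of `G/G_i`
and the exponent `Dsum = Σ_α D(G_i^{(α)})`; the quotient construction is not modelled here. [cite: Balaban1983Higgs3, (2.16) p.428] -/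
def Ineq216 (C : ℝ) (J : Finset (G.Ln → ℕ)) (Gq : ScaledGraph) (Jq : Finset (Gq.Ln → ℕ)) (lnext : Gq.Ln)
    (Dsum : ℝ) : Prop :=
  ∑ j ∈ J, G.Etilde j ≤ ∑ j ∈ Jq, C * Gq.scale (j lnext) ^ Dsum * Gq.Etilde j

/-- p. 428: *"For i = m we get the constant O(1) only on the right side of (2.16), hence the proof of the theorem is
finished"* — the bookkeeping behind it: for a carrier WITHOUT lines (the whole graph shrunk to one point; the carrier
clause `touches` then forces no vertices either) every weight (2.14) is an empty product, so `Ẽ = |locs|`.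
PROVED. [cite: Balaban1983Higgs3, (2.16) p.428] -/
theorem Etilde_noLines (hL : IsEmpty G.Ln) (j : G.Ln → ℕ) : G.Etilde j = G.locs.card := by
  have hV : IsEmpty G.V := ⟨fun v => by obtain ⟨l, _⟩ := G.touches v; exact hL.elim l⟩
  simp [ScaledGraph.Etilde, ScaledGraph.weight214, Finset.univ_eq_empty]

/-- (2.15) follows from (2.16) at the last stage once the right side is bounded: if the weight sum of `G` is bounded by
that of a quotient carrier (2.16) and the latter sum is at most `C′`, then (2.15) holds with `C′`. PROVED (bookkeeping).
[cite: Balaban1983Higgs3, (2.15)–(2.16) p.428] -/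
theorem ineq215_of_ineq216 {C C' : ℝ} {J : Finset (G.Ln → ℕ)} {Gq : ScaledGraph} {Jq : Finset (Gq.Ln → ℕ)}
    {lnext : Gq.Ln} {Dsum : ℝ} (h : Ineq216 G C J Gq Jq lnext Dsum)
    (hq : ∑ j ∈ Jq, C * Gq.scale (j lnext) ^ Dsum * Gq.Etilde j ≤ C') : Ineq215 G C' J :=
  le_trans h hq

end Claims

end Literature.MathematicalPhysics.QuantumFieldTheory.Balaban1983to89.B3Sect2FirstEstimate
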